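import Literature.Barriers.ValiantsHypothesis.AlgebraicNaturalProofs
import Literature.Computability.AlgebraicComplexity.StandardFamilies
import Literature.Computability.AlgebraicComplexity.DetInVP
import Literature.Computability.AlgebraicComplexity.ArithCircuit
import Literature.Computability.AlgebraicComplexity.IMMInVPProofs
import Literature.LinearAlgebra.Matrix.MvPolynomialDetDegree
import Summits.ValiantsHypothesis.ValiantsHypothesis.Theorems.BarrierLeverSuccinctHittingSetsForVPDimensionCount
import Summits.ValiantsHypothesis.ValiantsHypothesis.Theses.BarrierLever

/-!
# Route BarrierLever — the crux `SuccinctHittingSetsForVP` (stmt-ValiantsHypothesis-14610) implies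
# item `ReadOnceDeterminantsHitByVP` (stmt-ValiantsHypothesis-20152)

Lean text after the cell planner seat `valiant-natproofs-p1` (gen 5, HOME/p1/Bridge-g5.lean, farm
rc 0), landed by the prover seat as a `--supports stmt-ValiantsHypothesis-20152` helper: the ladder
arrow placing the support item 20152 ("read-once determinants are succinctly hit by `VP`",
Forbes–Shpilka–Volk 2018 §8, printed open for `𝒞 = VP`) BELOW the crux 14610 (FSV Question 6).

A read-once determinant of dimension `r ≤ N^a` (`N = C(2n, n)`; entries coefficient variables or
constants, each variable at most once) is the image of the generic determinant `detPoly (Fin r) ℂ`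
under a substitution by variables and constants, so by Berkowitz (`complexity_detPoly_le`,
`L(DET_r) ≤ 8 (r+1)^7`) and the substitution bound `complexity_aeval_le` (inputs and constants are
free) it has circuit size `≤ 8 (r+1)^7 ≤ N^(7a+4)` and (Leibniz, `totalDegree_det_le`) degree
`≤ r ≤ N^(7a+4)`; hence the read-once determinants of level `a` lie in `Distinguishers ℂ n (7a+4)`
for `n ≥ 4`, and `IsSuccinctHittingSet.mono` transports Question 6 at level `7a + 4` to the item at
level `a`. No `def`s: the item's distinguisher class is written inline, exactly as in the item's
signature. Does NOT close item 20152 (whose hypothesis-free statement stays open) nor the crux.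

* `readOnceDet_subset_distinguishers` — level-`a` read-once determinants ⊆ `Distinguishers ℂ n (7a+4)`.
* `readOnceDeterminantsHitByVP_of_succinctHittingSetsForVP` — FSV Question 6 over `ℂ` ⇒ item 20152
  (signature verbatim).
* `readOnceDeterminantsHitByVP_of_crux` — the same from the route's crux decl
  `Theses.BarrierLever.SuccinctHittingSetsForVP`.

WHAT THIS IS NOT: not a proof of item 20152; nothing about Question 6 itself.

References: [ForbesShpilkaVolk2018] Question 6, Cor. 5, §8; [Berkowitz1984] §2.
-/

-- layout Summits/ValiantsHypothesis/ValiantsHypothesis forces the duplicated namespace component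
set_option linter.dupNamespace false

noncomputable section

namespace Summit.ValiantsHypothesis.ValiantsHypothesis.Theorems.BarrierLever.ReadOnceDeterminantsHitByVP

open MvPolynomial Literature.Barriers.ValiantsHypothesis Literature.Computability.AlgebraicComplexity
open Summit.ValiantsHypothesis.ValiantsHypothesis.Theorems.BarrierLever.SuccinctHittingSetsForVP

variable {n : ℕ}

/-- A read-once determinant is the generic determinant under a substitution by variables and
constants. -/
theorem readOnceDet_eq_aeval {r : ℕ} (E : Matrix (Fin r) (Fin r) ((degLEMonomials n) ⊕ ℂ)) :
    (E.map (Sum.elim MvPolynomial.X MvPolynomial.C)).det =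
      aeval (fun ij : Fin r × Fin r =>
        (Sum.elim MvPolynomial.X MvPolynomial.C (E ij.1 ij.2) : MvPolynomial (degLEMonomials n) ℂ))
        (detPoly (Fin r) ℂ) := by
  unfold detPoly
  rw [AlgHom.map_det, AlgHom.mapMatrix_apply]
  congr 1
  ext i j
  simp [Matrix.mvPolynomialX_apply]

/-- Inputs and constants are free (`complexity_X_holds`, `complexity_C_holds`). -/
theorem complexity_entry_eq_zero (x : (degLEMonomials n) ⊕ ℂ) :
    complexity (Sum.elim MvPolynomial.X MvPolynomial.C x : MvPolynomial (degLEMonomials n) ℂ) = 0 := by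
  cases x with
  | inl m => exact complexity_X_holds m
  | inr z => exact complexity_C_holds z

/-- **Size of a read-once determinant**: `≤ 8 (r+1)^7` (Berkowitz `complexity_detPoly_le` + free
substitution `complexity_aeval_le`). [cite: Berkowitz1984, §2] -/
theorem complexity_readOnceDet_le {r : ℕ} (E : Matrix (Fin r) (Fin r) ((degLEMonomials n) ⊕ ℂ)) :
    complexity (E.map (Sum.elim MvPolynomial.X MvPolynomial.C)).det ≤ 8 * (r + 1) ^ 7 := by
  rw [readOnceDet_eq_aeval]
  refine (complexity_aeval_le _ _).trans ?_
  rw [Finset.sum_eq_zero (fun ij _ => complexity_entry_eq_zero (E ij.1 ij.2)), add_zero]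
  exact complexity_detPoly_le ℂ r

/-- **Degree of a read-once determinant**: `≤ r` (Leibniz, `totalDegree_det_le`). -/
theorem totalDegree_readOnceDet_le {r : ℕ} (E : Matrix (Fin r) (Fin r) ((degLEMonomials n) ⊕ ℂ)) :
    ((E.map (Sum.elim MvPolynomial.X MvPolynomial.C)).det).totalDegree ≤ r := by
  have h := Literature.LinearAlgebra.Matrix.totalDegree_det_le
    (E.map (Sum.elim MvPolynomial.X MvPolynomial.C)) (fun _ => 1) (fun j c => by
      rw [Matrix.map_apply]
      cases E j c with
      | inl m => simp [totalDegree_X]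
      | inr z => simp [totalDegree_C])
  simpa using h

/-- Arithmetic: `8 (r+1)^7 ≤ N^(7a+4)` when `r ≤ N^a` and `N ≥ 6`. -/
theorem size_arith {N a r : ℕ} (hN : 6 ≤ N) (hr : r ≤ N ^ a) : 8 * (r + 1) ^ 7 ≤ N ^ (7 * a + 4) := by
  have hNa : 1 ≤ N ^ a := Nat.one_le_pow a N (by omega)
  have h1 : r + 1 ≤ 2 * N ^ a := by omega
  have h4 : 1024 ≤ N ^ 4 := le_trans (by norm_num) (Nat.pow_le_pow_left hN 4)
  calc 8 * (r + 1) ^ 7 ≤ 8 * (2 * N ^ a) ^ 7 := Nat.mul_le_mul_left 8 (Nat.pow_le_pow_left h1 7)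
    _ = 1024 * (N ^ a) ^ 7 := by ring
    _ ≤ N ^ 4 * (N ^ a) ^ 7 := Nat.mul_le_mul_right _ h4
    _ = N ^ (7 * a + 4) := by rw [← pow_mul, ← pow_add]; ring_nf

/-- `N = C(2n, n) ≥ 6` for `n ≥ 4` (`2^n ≤ C(2n,n)`, tree `LowDegreeEquations.two_pow_le_choose`). -/
theorem six_le_choose (hn : 4 ≤ n) : 6 ≤ Nat.choose (2 * n) n :=
  le_trans (le_trans (by norm_num) (Nat.pow_le_pow_right (by norm_num) hn))
    (LowDegreeEquations.two_pow_le_choose hn)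

/-- **Read-once determinants of level `a` are level-`(7a+4)` distinguishers** (`n ≥ 4`): the
distinguisher class of item 20152, written inline exactly as in its signature, is contained in
`Distinguishers ℂ n (7a+4)`. [cite: ForbesShpilkaVolk2018, Cor. 5 and §8] -/
theorem readOnceDet_subset_distinguishers {a : ℕ} (hn : 4 ≤ n) :
    {D : MvPolynomial (degLEMonomials n) ℂ | ∃ (r : ℕ) (E : Matrix (Fin r) (Fin r)
        (↥(Literature.Barriers.ValiantsHypothesis.degLEMonomials n) ⊕ ℂ)),
      r ≤ (Nat.choose (2 * n) n) ^ a ∧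
      (∀ p q : Fin r × Fin r, ∀ m, E p.1 p.2 = Sum.inl m → E q.1 q.2 = Sum.inl m → p = q) ∧
      D = (E.map (Sum.elim MvPolynomial.X MvPolynomial.C)).det}
      ⊆ Distinguishers ℂ n (7 * a + 4) := by
  rintro D ⟨r, E, hr, -, rfl⟩
  have hN := six_le_choose hn
  refine ⟨(complexity_readOnceDet_le E).trans (size_arith hN hr),
    (totalDegree_readOnceDet_le E).trans (hr.trans ?_)⟩
  exact Nat.pow_le_pow_right (by omega) (by omega)

/-- **The ladder arrow**: FSV Question 6 over `ℂ` (`SuccinctHittingSetsForVP ℂ`) implies item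
stmt-ValiantsHypothesis-20152 `ReadOnceDeterminantsHitByVP` (conclusion = the item's signature
verbatim): at level `a` use Question 6 at level `7a + 4` and monotonicity in the distinguisher
class. [cite: ForbesShpilkaVolk2018, Question 6 and §8] -/
theorem readOnceDeterminantsHitByVP_of_succinctHittingSetsForVP (h : SuccinctHittingSetsForVP ℂ) :
    ∀ a : ℕ, ∃ b n₀ : ℕ, ∀ n : ℕ, n₀ ≤ n → Literature.Barriers.ValiantsHypothesis.IsSuccinctHittingSet (Literature.Barriers.ValiantsHypothesis.degLEMonomials n) (Literature.Barriers.ValiantsHypothesis.SmallCircuits ℂ n b) {D | ∃ (r : ℕ) (E : Matrix (Fin r) (Fin r) (↥(Literature.Barriers.ValiantsHypothesis.degLEMonomials n) ⊕ ℂ)), r ≤ (Nat.choose (2 * n) n) ^ a ∧ (∀ p q : Fin r × Fin r, ∀ m, E p.1 p.2 = Sum.inl m → E q.1 q.2 = Sum.inl m → p = q) ∧ D = (E.map (Sum.elim MvPolynomial.X MvPolynomial.C)).det} := by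
  intro a
  obtain ⟨b, n₀, hb⟩ := h (7 * a + 4)
  refine ⟨b, max n₀ 4, fun n hn => ?_⟩
  exact (hb n ((le_max_left _ _).trans hn)).mono subset_rfl
    (readOnceDet_subset_distinguishers ((le_max_right _ _).trans hn))

/-- The same arrow from the ROUTE's crux decl `Theses.BarrierLever.SuccinctHittingSetsForVP`
(item stmt-ValiantsHypothesis-14610): crux ⇒ item 20152 (signature verbatim). -/
theorem readOnceDeterminantsHitByVP_of_crux
    (h : Summit.ValiantsHypothesis.ValiantsHypothesis.Theses.BarrierLever.SuccinctHittingSetsForVP) :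
    ∀ a : ℕ, ∃ b n₀ : ℕ, ∀ n : ℕ, n₀ ≤ n → Literature.Barriers.ValiantsHypothesis.IsSuccinctHittingSet (Literature.Barriers.ValiantsHypothesis.degLEMonomials n) (Literature.Barriers.ValiantsHypothesis.SmallCircuits ℂ n b) {D | ∃ (r : ℕ) (E : Matrix (Fin r) (Fin r) (↥(Literature.Barriers.ValiantsHypothesis.degLEMonomials n) ⊕ ℂ)), r ≤ (Nat.choose (2 * n) n) ^ a ∧ (∀ p q : Fin r × Fin r, ∀ m, E p.1 p.2 = Sum.inl m → E q.1 q.2 = Sum.inl m → p = q) ∧ D = (E.map (Sum.elim MvPolynomial.X MvPolynomial.C)).det} :=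
  readOnceDeterminantsHitByVP_of_succinctHittingSetsForVP h

end Summit.ValiantsHypothesis.ValiantsHypothesis.Theorems.BarrierLever.ReadOnceDeterminantsHitByVP

end
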